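import Literature.Analysis.FunctionSpaces.LiebWuEnergyDerivative
import Literature.Analysis.FunctionSpaces.LiebWuEnergyStrongCouplingSeries
import Mathlib.Analysis.Calculus.LHopital
import HarnessLib

/-!
# The weak-coupling end of the half-filled Lieb–Wu energy: `d(0⁺) = 1/4`, the Hartree slope, and the
# Hartree–Fock sandwich `-4/π ≤ e(U) ≤ -4/π + U/4`

Family `hubbard`; seat L5 LIT 1 of the `hubbard-alg` programme (Lieb–Wu 1968 AS PRINTED, `BENCHMARKS.md` §4).
The tree has the half-filled Bethe-ansatz energy `e(U) = liebWuEnergy U = -4 ∫₀^∞ J₀J₁ dω/(ω(1 + e^{ωU/2}))`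
(Lieb–Wu eq. (20)), its derivative `d(U) = liebWuDoubleOccupancy U` (`hasDerivAt_liebWuEnergy`), the free limit
`e(0⁺) = -4/π` (`tendsto_liebWuEnergy_zero_holds`), the strong-coupling series (`U > 4`) and the kink/analyticity
statements. This file adds the WEAK-COUPLING end and the global closed-form consequences, all from one integration by
parts: with `∫₀^ω J₀J₁ = (1 - J₀(ω)²)/2` and the logistic weight `w(x) = eˣ/(1 + eˣ)²`, `w(0) = 1/4`,

* `liebWuDoubleOccupancy_eq_quarter_add'` — **`d(U) = 1/4 + ∫₀^∞ J₀(2y/U)² w'(y) dy`** (`U > 0`), `w' = eˣ(1-eˣ)/(1+eˣ)³ ≤ 0`;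

whence, since `0 ≤ J₀² ≤ 1`, `∫₀^∞ w' = -1/4`, `J₀(2y/U) → 0` (`U → 0⁺`) and `→ 1` (`U → ∞`) under the integrable
dominant `e^{-y}`:

* `tendsto_liebWuDoubleOccupancy_nhdsGT_zero` — **`d(U) → 1/4` as `U → 0⁺`** (the uncorrelated value `⟨n↑⟩⟨n↓⟩`);
* `tendsto_liebWuEnergy_add_div_nhdsGT_zero` — **`(e(U) + 4/π)/U → 1/4`**: `e(U) = -4/π + U/4 + o(U)`, the first two
  terms of the small-`u` expansion printed as Essler et al. (6.84), `f(u) = e - u = -4/π - 7ζ(3)u²/π³ - …` ("an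
  asymptotic expansion with zero radius of convergence"; the `ζ(3)` coefficient is NOT formalised here);
* `liebWuDoubleOccupancy_nonneg`, `liebWuDoubleOccupancy_le_quarter` — **`0 ≤ d(U) ≤ 1/4`** for every `U > 0`;
* `monotoneOn_liebWuEnergy`, `antitoneOn_liebWuEnergy_sub_quarter_mul` — `e` non-decreasing, `e - U/4` non-increasing;
* `neg_four_div_pi_le_liebWuEnergy`, `liebWuEnergy_le_hartreeFock`, `liebWuEnergy_nonpos` — **`-4/π ≤ e(U) ≤ -4/π + U/4`
  and `e(U) ≤ 0`** for every `U > 0` (for the chain these are the `U ≥ 0` monotonicity bound and the variational bound of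
  the paramagnetic Hartree–Fock state; here they are theorems about the Bethe-ansatz function itself, no `lieb_wu`);
* `tendsto_liebWuDoubleOccupancy_atTop`, `tendsto_liebWuEnergy_atTop` — `d(U) → 0`, `e(U) → 0` as `U → ∞`.

Zero named facts. HONEST FRAMING: statements about the Bethe-ansatz integrals; their identification with the chain is the
named fact `lieb_wu`; not numbers of record; not a superconductivity verdict.

## References

* F. H. L. Essler, H. Frahm, F. Göhmann, A. Klümper, V. E. Korepin, *The One-Dimensional Hubbard Model*, CUP 2005, §6.7
  eq. (6.84), PDF p. 209 (key `EsslerEtAl2005`).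
* E. H. Lieb, F. Y. Wu, PRL 20 (1968) 1445, eq. (20) (key `LiebWuPRL1968`).
* J. Oitmaa, C. Hamer, W. Zheng, CUP 2006, §8.2.1 eq. (8.7) (key `OitmaaHamerZheng2006`).
-/

noncomputable section

open Filter Set Real MeasureTheory
open scoped Topology

namespace Literature.Analysis.FunctionSpaces

/-! ## The logistic weight `w(x) = eˣ/(1 + eˣ)²` and its derivative `w'(x) = eˣ(1 - eˣ)/(1 + eˣ)³` -/

/-- `w' = eˣ(1-eˣ)/(1+eˣ)³`. [folklore] -/
private theorem hasDerivAt_logisticWeight (x : ℝ) :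
    HasDerivAt (fun x => Real.exp x / (1 + Real.exp x) ^ 2)
      (Real.exp x * (1 - Real.exp x) / (1 + Real.exp x) ^ 3) x := by
  have h1 := Real.hasDerivAt_exp x
  have h2 : HasDerivAt (fun x => (1 + Real.exp x) ^ 2) (((2 : ℕ) : ℝ) * (1 + Real.exp x) ^ (2 - 1) * Real.exp x) x :=
    (h1.const_add 1).fun_pow 2
  have hne : (1 + Real.exp x) ^ 2 ≠ 0 := by positivity
  have h := h1.div h2 hne
  refine h.congr_deriv ?_
  have hpos : 0 < 1 + Real.exp x := by positivity
  field_simp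
  norm_num
  ring

/-- `|eˣ(1-eˣ)/(1+eˣ)³| ≤ e⁻ˣ` for all real `x`. [folklore] -/
private theorem abs_logisticWeight_deriv_le (x : ℝ) :
    |Real.exp x * (1 - Real.exp x) / (1 + Real.exp x) ^ 3| ≤ Real.exp (-x) := by
  have hE := Real.exp_pos x
  have hden : 0 < (1 + Real.exp x) ^ 3 := by positivity
  rw [abs_div, abs_of_pos hden, div_le_iff₀ hden, abs_mul, abs_of_pos hE, Real.exp_neg]
  have h1 : |1 - Real.exp x| ≤ 1 + Real.exp x := by
    rw [abs_le]; constructor <;> linarith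
  calc Real.exp x * |1 - Real.exp x| ≤ Real.exp x * (1 + Real.exp x) := by gcongr
    _ ≤ (Real.exp x)⁻¹ * (1 + Real.exp x) ^ 3 := by
        rw [← div_le_iff₀' (by positivity), div_inv_eq_mul]
        nlinarith [sq_nonneg (Real.exp x), hE]

/-- `eˣ/(1+eˣ)² ≤ e⁻ˣ`. [folklore] -/
private theorem logisticWeight_le (x : ℝ) : Real.exp x / (1 + Real.exp x) ^ 2 ≤ Real.exp (-x) := by
  have hE := Real.exp_pos x
  rw [div_le_iff₀ (by positivity), Real.exp_neg, ← div_le_iff₀' (by positivity), div_inv_eq_mul]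
  nlinarith [sq_nonneg (Real.exp x), hE]

/-- `e^{-y}` is integrable on `(0, ∞)`. [folklore] -/
private theorem integrableOn_exp_neg_Ioi_zero : IntegrableOn (fun y : ℝ => Real.exp (-y)) (Ioi 0) := by
  refine (exp_neg_integrableOn_Ioi 0 zero_lt_one).congr_fun (fun y _ => ?_) measurableSet_Ioi
  simp

/-! ## Integration by parts: `d(U) = 1/4 + (U/2) ∫₀^∞ J₀(ω)² w'(ωU/2) dω` -/

section WeakCoupling

variable {U : ℝ}

/-- The `ω`-derivative of the Fermi weight `φ_U(ω) = e^{ωU/2}/(1 + e^{ωU/2})²`: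
`φ_U' = (U/2) w'(ωU/2)`. [folklore] -/
private theorem hasDerivAt_fermiWeight (U ω : ℝ) :
    HasDerivAt (fun ω => Real.exp (ω * U / 2) / (1 + Real.exp (ω * U / 2)) ^ 2)
      (U / 2 * (Real.exp (ω * U / 2) * (1 - Real.exp (ω * U / 2)) / (1 + Real.exp (ω * U / 2)) ^ 3)) ω := by
  have hlin : HasDerivAt (fun ω : ℝ => ω * U / 2) (U / 2) ω := by
    simpa using ((hasDerivAt_id ω).mul_const U).div_const 2
  have h := (hasDerivAt_logisticWeight (ω * U / 2)).comp ω hlin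
  rw [show U / 2 * (Real.exp (ω * U / 2) * (1 - Real.exp (ω * U / 2)) / (1 + Real.exp (ω * U / 2)) ^ 3) =
    Real.exp (ω * U / 2) * (1 - Real.exp (ω * U / 2)) / (1 + Real.exp (ω * U / 2)) ^ 3 * (U / 2) from mul_comm _ _]
  exact h

/-- **Integration by parts on `(0, ∞)`**: for `U > 0`,
`∫₀^∞ J₀J₁ e^{ωU/2}/(2(1+e^{ωU/2})²) dω = 1/16 + (U/8) ∫₀^∞ J₀(ω)² w'(ωU/2) dω`, `w'(x) = eˣ(1-eˣ)/(1+eˣ)³`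
(`∫₀^ω J₀J₁ = (1 - J₀(ω)²)/2`, the boundary terms vanish, `∫₀^∞ w'(ωU/2) dω = -1/(2U)`).
[cite: LiebWuPRL1968, eq. (20)] -/
theorem integral_liebWuDoccIntegrand_eq (hU : 0 < U) :
    ∫ ω in Ioi (0 : ℝ), liebWuDoccIntegrand U ω =
      1 / 16 + U / 8 * ∫ ω in Ioi (0 : ℝ), besselJ 0 ω ^ 2 *
        (Real.exp (ω * U / 2) * (1 - Real.exp (ω * U / 2)) / (1 + Real.exp (ω * U / 2)) ^ 3) := by
  have hU0 : U ≠ 0 := hU.ne'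
  -- notation
  set φ : ℝ → ℝ := fun ω => Real.exp (ω * U / 2) / (1 + Real.exp (ω * U / 2)) ^ 2 with hφ
  set ψ : ℝ → ℝ := fun ω =>
    Real.exp (ω * U / 2) * (1 - Real.exp (ω * U / 2)) / (1 + Real.exp (ω * U / 2)) ^ 3 with hψ
  set P : ℝ → ℝ := fun ω => (1 - besselJ 0 ω ^ 2) / 2 with hP
  have hφ' : ∀ ω, HasDerivAt φ (U / 2 * ψ ω) ω := fun ω => hasDerivAt_fermiWeight U ω
  have hP' : ∀ ω, HasDerivAt P (besselJ 0 ω * besselJ 1 ω) ω := by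
    intro ω
    have h := (((hasDerivAt_besselJ_zero_holds ω).fun_pow 2).const_sub 1).div_const 2
    refine h.congr_deriv ?_
    norm_num
    ring
  have hψ_cont : Continuous ψ := by
    rw [hψ]
    exact Continuous.div (by fun_prop) (by fun_prop) fun ω => by positivity
  have hφ_cont : Continuous φ := by
    rw [hφ]
    exact Continuous.div (by fun_prop) (by fun_prop) fun ω => by positivity
  have hP_cont : Continuous P := by
    rw [hP]
    exact (continuous_const.sub ((continuous_besselJ_holds 0).pow 2)).div_const 2
  have hψ_le : ∀ ω, |ψ ω| ≤ Real.exp (-(U / 2) * ω) := fun ω => by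
    rw [hψ, show -(U / 2) * ω = -(ω * U / 2) by ring]
    exact abs_logisticWeight_deriv_le _
  have hP_abs : ∀ ω, |P ω| ≤ 1 / 2 := fun ω => by
    have h1 := abs_besselJ_zero_le_one_holds ω
    have h2 : besselJ 0 ω ^ 2 ≤ 1 := by
      have := sq_le_one_iff_abs_le_one (besselJ 0 ω) |>.mpr h1; exact this
    rw [hP]
    simp only
    rw [abs_le]
    constructor <;> nlinarith [sq_nonneg (besselJ 0 ω)]
  have hexpU : IntegrableOn (fun ω : ℝ => Real.exp (-(U / 2) * ω)) (Ioi 0) :=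
    exp_neg_integrableOn_Ioi 0 (by positivity)
  -- integrability of `ψ` and of `ψ · P`, `ψ · J₀²`
  have hψ_int : IntegrableOn ψ (Ioi 0) := by
    refine Integrable.mono' hexpU hψ_cont.aestronglyMeasurable (Eventually.of_forall fun ω => ?_)
    rw [Real.norm_eq_abs]; exact hψ_le ω
  have hψP_int : IntegrableOn (fun ω => U / 2 * ψ ω * P ω) (Ioi 0) := by
    refine Integrable.mono' (hexpU.const_mul (U / 2 * (1 / 2)))
      (((continuous_const.mul hψ_cont).mul hP_cont).aestronglyMeasurable) (Eventually.of_forall fun ω => ?_)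
    rw [Real.norm_eq_abs, abs_mul, abs_mul, abs_of_pos (by positivity : (0 : ℝ) < U / 2)]
    have := hψ_le ω
    have := hP_abs ω
    calc U / 2 * |ψ ω| * |P ω| ≤ U / 2 * Real.exp (-(U / 2) * ω) * (1 / 2) := by
          gcongr
      _ = U / 2 * (1 / 2) * Real.exp (-(U / 2) * ω) := by ring
  have hψJ_int : IntegrableOn (fun ω => besselJ 0 ω ^ 2 * ψ ω) (Ioi 0) := by
    refine Integrable.mono' hexpU ((((continuous_besselJ_holds 0).pow 2).mul hψ_cont).aestronglyMeasurable)
      (Eventually.of_forall fun ω => ?_)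
    rw [Real.norm_eq_abs, abs_mul]
    have h1 : |besselJ 0 ω ^ 2| ≤ 1 := by
      rw [abs_of_nonneg (sq_nonneg _)]
      exact (sq_le_one_iff_abs_le_one _).mpr (abs_besselJ_zero_le_one_holds ω)
    calc |besselJ 0 ω ^ 2| * |ψ ω| ≤ 1 * Real.exp (-(U / 2) * ω) := by gcongr; exact hψ_le ω
      _ = Real.exp (-(U / 2) * ω) := one_mul _
  -- `φ · J₀J₁` is twice the docc integrand
  have hφJ_int : IntegrableOn (fun ω => φ ω * (besselJ 0 ω * besselJ 1 ω)) (Ioi 0) := by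
    have h : IntegrableOn (fun ω => 2 * liebWuDoccIntegrand U ω) (Ioi 0) :=
      (integrableOn_liebWuDoccIntegrand hU).const_mul 2
    refine IntegrableOn.congr_fun h (fun ω _ => ?_) measurableSet_Ioi
    simp only [liebWuDoccIntegrand, hφ]
    have : (0 : ℝ) < (1 + Real.exp (ω * U / 2)) ^ 2 := by positivity
    field_simp
  -- boundary behaviour of `φ · P`
  have h_zero : Tendsto (fun ω => φ ω * P ω) (𝓝[>] (0 : ℝ)) (𝓝 0) := by
    have hc : Continuous fun ω => φ ω * P ω := hφ_cont.mul hP_cont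
    have h0 : φ 0 * P 0 = 0 := by simp [hP, besselJ_zero_zero]
    have h := (hc.tendsto 0).mono_left (nhdsWithin_le_nhds (s := Ioi (0 : ℝ)))
    rwa [h0] at h
  have h_infty : Tendsto (fun ω => φ ω * P ω) atTop (𝓝 0) := by
    have hbound : ∀ ω, |φ ω * P ω| ≤ Real.exp (-(U / 2) * ω) * (1 / 2) := fun ω => by
      rw [abs_mul]
      have h1 : |φ ω| ≤ Real.exp (-(U / 2) * ω) := by
        rw [hφ]
        simp only
        rw [abs_of_pos (by positivity), show -(U / 2) * ω = -(ω * U / 2) by ring]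
        exact logisticWeight_le _
      gcongr
      exact hP_abs ω
    have hexp0 : Tendsto (fun ω : ℝ => Real.exp (-(U / 2) * ω) * (1 / 2)) atTop (𝓝 0) := by
      have : Tendsto (fun ω : ℝ => Real.exp (-(U / 2) * ω)) atTop (𝓝 0) := by
        have h := Real.tendsto_exp_neg_atTop_nhds_zero.comp
          (Filter.Tendsto.const_mul_atTop (by positivity : 0 < U / 2) tendsto_id)
        refine h.congr fun ω => ?_
        simp only [Function.comp, id]; ring_nf
      have h2 := this.mul_const (1 / 2)
      rw [zero_mul] at h2
      exact h2
    exact squeeze_zero_norm (fun ω => by rw [Real.norm_eq_abs]; exact hbound ω) hexp0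
  -- integration by parts
  have hIBP := integral_Ioi_mul_deriv_eq_deriv_mul (u := φ) (v := P) (u' := fun ω => U / 2 * ψ ω)
    (v' := fun ω => besselJ 0 ω * besselJ 1 ω) (a := 0) (a' := 0) (b' := 0)
    (fun ω _ => hφ' ω) (fun ω _ => hP' ω) hφJ_int (by simpa [Pi.mul_def] using hψP_int)
    (by simpa [Pi.mul_def] using h_zero) (by simpa [Pi.mul_def] using h_infty)
  -- `∫₀^∞ ψ = -1/(2U)` (antiderivative `(2/U) w(ωU/2)`)
  have hψ_val : ∫ ω in Ioi (0 : ℝ), ψ ω = -(1 / (2 * U)) := by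
    have hF : ∀ ω ∈ Ioi (0 : ℝ), HasDerivAt (fun ω => 2 / U * φ ω) (ψ ω) ω := by
      intro ω _
      have h := (hφ' ω).const_mul (2 / U)
      exact h.congr_deriv (by field_simp)
    have hcont : ContinuousWithinAt (fun ω => 2 / U * φ ω) (Ici 0) 0 :=
      ((continuous_const.mul hφ_cont).continuousAt).continuousWithinAt
    have hlim : Tendsto (fun ω => 2 / U * φ ω) atTop (𝓝 (2 / U * 0)) := by
      refine Tendsto.const_mul _ ?_
      have hbound : ∀ ω, |φ ω| ≤ Real.exp (-(U / 2) * ω) := fun ω => by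
        rw [hφ]
        simp only
        rw [abs_of_pos (by positivity), show -(U / 2) * ω = -(ω * U / 2) by ring]
        exact logisticWeight_le _
      have hexp0 : Tendsto (fun ω : ℝ => Real.exp (-(U / 2) * ω)) atTop (𝓝 0) := by
        have h := Real.tendsto_exp_neg_atTop_nhds_zero.comp
          (Filter.Tendsto.const_mul_atTop (by positivity : 0 < U / 2) tendsto_id)
        refine h.congr fun ω => ?_
        simp only [Function.comp, id]; ring_nf
      exact squeeze_zero_norm (fun ω => by rw [Real.norm_eq_abs]; exact hbound ω) hexp0
    rw [mul_zero] at hlim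
    have h := integral_Ioi_of_hasDerivAt_of_tendsto hcont hF hψ_int hlim
    rw [h]
    simp [hφ]
    field_simp
    norm_num
  -- assemble
  have hlhs : ∫ ω in Ioi (0 : ℝ), liebWuDoccIntegrand U ω =
      1 / 2 * ∫ ω in Ioi (0 : ℝ), φ ω * (besselJ 0 ω * besselJ 1 ω) := by
    rw [← integral_const_mul]
    refine setIntegral_congr_fun measurableSet_Ioi fun ω _ => ?_
    simp only [liebWuDoccIntegrand, hφ]
    have : (0 : ℝ) < (1 + Real.exp (ω * U / 2)) ^ 2 := by positivity
    field_simp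
  have hrhs : ∫ ω in Ioi (0 : ℝ), U / 2 * ψ ω * P ω =
      U / 4 * (∫ ω in Ioi (0 : ℝ), ψ ω) - U / 4 * ∫ ω in Ioi (0 : ℝ), besselJ 0 ω ^ 2 * ψ ω := by
    have e1 : (fun ω => U / 2 * ψ ω * P ω) = fun ω => U / 4 * ψ ω - U / 4 * (besselJ 0 ω ^ 2 * ψ ω) := by
      funext ω; simp only [hP]; ring
    rw [e1, integral_sub (hψ_int.const_mul _) (hψJ_int.const_mul _), integral_const_mul, integral_const_mul]
  show (∫ ω in Ioi (0 : ℝ), liebWuDoccIntegrand U ω) = 1 / 16 + U / 8 * ∫ ω in Ioi (0 : ℝ), besselJ 0 ω ^ 2 * ψ ω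
  rw [hlhs, hIBP, hrhs, hψ_val]
  field_simp
  ring

/-- **`d(U) = 1/4 + (U/2) ∫₀^∞ J₀(ω)² w'(ωU/2) dω`** for `U > 0`. [cite: LiebWuPRL1968, eq. (20)] -/
theorem liebWuDoubleOccupancy_eq_quarter_add (hU : 0 < U) :
    liebWuDoubleOccupancy U = 1 / 4 + U / 2 * ∫ ω in Ioi (0 : ℝ), besselJ 0 ω ^ 2 *
      (Real.exp (ω * U / 2) * (1 - Real.exp (ω * U / 2)) / (1 + Real.exp (ω * U / 2)) ^ 3) := by
  rw [liebWuDoubleOccupancy, integral_liebWuDoccIntegrand_eq hU]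
  ring

/-- The correction after the substitution `ω = 2y/U`:
`(U/2) ∫₀^∞ J₀(ω)² w'(ωU/2) dω = ∫₀^∞ J₀(2y/U)² w'(y) dy`. [cite: LiebWuPRL1968, eq. (20)] -/
theorem liebWuDoubleOccupancy_eq_quarter_add' (hU : 0 < U) :
    liebWuDoubleOccupancy U = 1 / 4 + ∫ y in Ioi (0 : ℝ), besselJ 0 (2 * y / U) ^ 2 *
      (Real.exp y * (1 - Real.exp y) / (1 + Real.exp y) ^ 3) := by
  rw [liebWuDoubleOccupancy_eq_quarter_add hU]
  congr 1
  set G : ℝ → ℝ := fun y => besselJ 0 (2 * y / U) ^ 2 * (Real.exp y * (1 - Real.exp y) / (1 + Real.exp y) ^ 3)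
    with hG
  have hsub := integral_comp_mul_left_Ioi G 0 (by positivity : 0 < U / 2)
  rw [mul_zero] at hsub
  have e : (fun ω : ℝ => G (U / 2 * ω)) = fun ω => besselJ 0 ω ^ 2 *
      (Real.exp (ω * U / 2) * (1 - Real.exp (ω * U / 2)) / (1 + Real.exp (ω * U / 2)) ^ 3) := by
    funext ω
    simp only [hG]
    have hU0 : U ≠ 0 := hU.ne'
    rw [show 2 * (U / 2 * ω) / U = ω by field_simp, show U / 2 * ω = ω * U / 2 by ring]
  rw [e] at hsub
  rw [hsub, smul_eq_mul]
  have hU0 : U ≠ 0 := hU.ne'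
  field_simp

/-- **The correction vanishes as `U → 0⁺`**: `∫₀^∞ J₀(2y/U)² w'(y) dy → 0` (dominated convergence: `|J₀| ≤ 1`,
`|w'(y)| ≤ e^{-y}`, and `J₀(2y/U) → 0` for every `y > 0` by the decay `|J₀(x)| ≤ C x^{-1/2}`).
[cite: LiebWuPRL1968, eq. (20)] -/
theorem tendsto_integral_besselJ_sq_logistic_nhdsGT_zero :
    Tendsto (fun U : ℝ => ∫ y in Ioi (0 : ℝ), besselJ 0 (2 * y / U) ^ 2 *
      (Real.exp y * (1 - Real.exp y) / (1 + Real.exp y) ^ 3)) (𝓝[>] 0) (𝓝 0) := by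
  set W : ℝ → ℝ := fun y => Real.exp y * (1 - Real.exp y) / (1 + Real.exp y) ^ 3 with hW
  have hW_cont : Continuous W := by
    rw [hW]; exact Continuous.div (by fun_prop) (by fun_prop) fun y => by positivity
  have h := tendsto_integral_filter_of_dominated_convergence (μ := volume.restrict (Ioi (0 : ℝ)))
    (l := 𝓝[>] (0 : ℝ)) (F := fun U y => besselJ 0 (2 * y / U) ^ 2 * W y) (f := fun _ => 0)
    (fun y => Real.exp (-y)) ?_ ?_ ?_ ?_
  · simpa using h
  · refine Eventually.of_forall fun U => ?_
    have hc : Continuous fun y => besselJ 0 (2 * y / U) ^ 2 * W y :=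
      (((continuous_besselJ_holds 0).comp (by fun_prop : Continuous fun y : ℝ => 2 * y / U)).pow 2).mul hW_cont
    exact hc.aestronglyMeasurable
  · refine Eventually.of_forall fun U => ae_of_all _ fun y => ?_
    rw [Real.norm_eq_abs, abs_mul]
    have h1 : |besselJ 0 (2 * y / U) ^ 2| ≤ 1 := by
      rw [abs_of_nonneg (sq_nonneg _)]
      exact (sq_le_one_iff_abs_le_one _).mpr (abs_besselJ_zero_le_one_holds _)
    calc |besselJ 0 (2 * y / U) ^ 2| * |W y| ≤ 1 * Real.exp (-y) := by
          gcongr; exact abs_logisticWeight_deriv_le y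
      _ = Real.exp (-y) := one_mul _
  · exact integrableOn_exp_neg_Ioi_zero
  · rw [ae_restrict_iff' measurableSet_Ioi]
    refine ae_of_all _ fun y hy => ?_
    have hy : (0 : ℝ) < y := hy
    -- `J₀(2y/U) → 0` as `U → 0⁺`
    obtain ⟨C, hC⟩ := abs_besselJ_le_mul_rpow_neg_half 0
    have hx : Tendsto (fun U : ℝ => 2 * y / U) (𝓝[>] 0) atTop := by
      have h := (tendsto_inv_nhdsGT_zero (𝕜 := ℝ)).const_mul_atTop (by positivity : 0 < 2 * y)
      refine h.congr fun U => ?_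
      rw [div_eq_mul_inv]
    have hJ : Tendsto (fun U : ℝ => besselJ 0 (2 * y / U)) (𝓝[>] 0) (𝓝 0) := by
      have hdecay : Tendsto (fun x : ℝ => C * x ^ (-(1 / 2 : ℝ))) atTop (𝓝 (C * 0)) :=
        (tendsto_rpow_neg_atTop (by norm_num : (0 : ℝ) < 1 / 2)).const_mul C
      rw [mul_zero] at hdecay
      have hev : ∀ᶠ U in 𝓝[>] (0 : ℝ), ‖besselJ 0 (2 * y / U)‖ ≤ C * (2 * y / U) ^ (-(1 / 2 : ℝ)) := by
        filter_upwards [hx.eventually (eventually_ge_atTop ((0 : ℝ) + 1))] with U hU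
        rw [Real.norm_eq_abs]
        exact hC _ (by simpa using hU)
      have hg : Tendsto (fun U : ℝ => C * (2 * y / U) ^ (-(1 / 2 : ℝ))) (𝓝[>] 0) (𝓝 0) := hdecay.comp hx
      exact squeeze_zero_norm' hev hg
    have := (hJ.pow 2).mul_const (W y)
    simpa using this

/-- **The Lieb–Wu double occupancy tends to `1/4` as `U → 0⁺`** — the uncorrelated value `⟨n↑⟩⟨n↓⟩ = n²/4` at
half filling; equivalently the small-`u` expansion of the energy starts `e(U) = -4/π + U/4 + o(U)` (Essler et al. 2005
eq. (6.84) with `f = e - u`, `u = U/4`: `f = -4/π - 7ζ(3)u²/π³ - …`, no linear term). [cite: EsslerEtAl2005, eq. (6.84)] -/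
theorem tendsto_liebWuDoubleOccupancy_nhdsGT_zero : Tendsto liebWuDoubleOccupancy (𝓝[>] 0) (𝓝 (1 / 4)) := by
  have h := tendsto_integral_besselJ_sq_logistic_nhdsGT_zero.const_add (1 / 4)
  rw [add_zero] at h
  refine h.congr' ?_
  filter_upwards [self_mem_nhdsWithin] with U hU
  exact (liebWuDoubleOccupancy_eq_quarter_add' hU).symm

/-- **The Hartree slope of the Lieb–Wu energy**: `(e(U) + 4/π)/U → 1/4` as `U → 0⁺`, i.e.
`e(U) = -4/π + U/4 + o(U)` — the first two terms of the small-`u` expansion (6.84) (an asymptotic series with zero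
radius of convergence; its next term is `-7ζ(3)U²/(16π³)`, not formalised). L'Hôpital with `e' = d`
(`hasDerivAt_liebWuEnergy`), `e(0⁺) = -4/π` (`tendsto_liebWuEnergy_zero_holds`) and `d(0⁺) = 1/4`.
[cite: EsslerEtAl2005, eq. (6.84)] -/
theorem tendsto_liebWuEnergy_add_div_nhdsGT_zero :
    Tendsto (fun U : ℝ => (liebWuEnergy U + 4 / π) / U) (𝓝[>] 0) (𝓝 (1 / 4)) := by
  have hmem : ∀ᶠ U in 𝓝[>] (0 : ℝ), 0 < U := self_mem_nhdsWithin
  refine HasDerivAt.lhopital_zero_nhdsGT (f' := liebWuDoubleOccupancy) (g' := fun _ => (1 : ℝ)) ?_ ?_ ?_ ?_ ?_ ?_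
  · filter_upwards [hmem] with U hU
    exact (hasDerivAt_liebWuEnergy hU).add_const _
  · exact Eventually.of_forall fun U => hasDerivAt_id U
  · exact Eventually.of_forall fun _ => one_ne_zero
  · have h := tendsto_liebWuEnergy_zero_holds
    unfold tendsto_liebWuEnergy_zero at h
    have h2 := h.add_const (4 / π)
    rw [show (-4 / π + 4 / π : ℝ) = 0 by ring] at h2
    exact h2
  · exact (continuous_id.tendsto 0).mono_left nhdsWithin_le_nhds
  · simpa using tendsto_liebWuDoubleOccupancy_nhdsGT_zero

/-! ## Uniform consequences: `0 ≤ d(U) ≤ 1/4`, the Hartree–Fock sandwich `-4/π ≤ e(U) ≤ -4/π + U/4`, `d(∞) = 0` -/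

/-- `∫₀^∞ w'(y) dy = -w(0) = -1/4`. [folklore] -/
private theorem integral_logisticWeight_deriv :
    ∫ y in Ioi (0 : ℝ), Real.exp y * (1 - Real.exp y) / (1 + Real.exp y) ^ 3 = -(1 / 4) := by
  have hF : ∀ y ∈ Ioi (0 : ℝ), HasDerivAt (fun y => Real.exp y / (1 + Real.exp y) ^ 2)
      (Real.exp y * (1 - Real.exp y) / (1 + Real.exp y) ^ 3) y := fun y _ => hasDerivAt_logisticWeight y
  have hwc : Continuous fun y : ℝ => Real.exp y / (1 + Real.exp y) ^ 2 :=
    Continuous.div (by fun_prop) (by fun_prop) fun y => by positivity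
  have hcont : ContinuousWithinAt (fun y => Real.exp y / (1 + Real.exp y) ^ 2) (Ici 0) 0 :=
    hwc.continuousAt.continuousWithinAt
  have hW_cont : Continuous fun y : ℝ => Real.exp y * (1 - Real.exp y) / (1 + Real.exp y) ^ 3 :=
    Continuous.div (by fun_prop) (by fun_prop) fun y => by positivity
  have hint : IntegrableOn (fun y => Real.exp y * (1 - Real.exp y) / (1 + Real.exp y) ^ 3) (Ioi 0) := by
    refine Integrable.mono' integrableOn_exp_neg_Ioi_zero hW_cont.aestronglyMeasurable (Eventually.of_forall fun y => ?_)
    rw [Real.norm_eq_abs]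
    exact abs_logisticWeight_deriv_le y
  have hlim : Tendsto (fun y : ℝ => Real.exp y / (1 + Real.exp y) ^ 2) atTop (𝓝 0) := by
    refine squeeze_zero_norm (fun y => ?_) Real.tendsto_exp_neg_atTop_nhds_zero
    rw [Real.norm_eq_abs, abs_of_pos (by positivity)]
    exact logisticWeight_le y
  rw [integral_Ioi_of_hasDerivAt_of_tendsto hcont hF hint hlim]
  norm_num

/-- Integrability of `y ↦ J₀(2y/U)² w'(y)` on `(0, ∞)` (dominated by `e^{-y}`). [folklore] -/
private theorem integrableOn_besselJ_sq_mul_logisticWeight_deriv (U : ℝ) :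
    IntegrableOn (fun y : ℝ => besselJ 0 (2 * y / U) ^ 2 *
      (Real.exp y * (1 - Real.exp y) / (1 + Real.exp y) ^ 3)) (Ioi 0) := by
  have hW_cont : Continuous fun y : ℝ => Real.exp y * (1 - Real.exp y) / (1 + Real.exp y) ^ 3 :=
    Continuous.div (by fun_prop) (by fun_prop) fun y => by positivity
  have hc : Continuous fun y => besselJ 0 (2 * y / U) ^ 2 *
      (Real.exp y * (1 - Real.exp y) / (1 + Real.exp y) ^ 3) :=
    (((continuous_besselJ_holds 0).comp (by fun_prop : Continuous fun y : ℝ => 2 * y / U)).pow 2).mul hW_cont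
  refine Integrable.mono' integrableOn_exp_neg_Ioi_zero hc.aestronglyMeasurable (Eventually.of_forall fun y => ?_)
  rw [Real.norm_eq_abs, abs_mul]
  have h1 : |besselJ 0 (2 * y / U) ^ 2| ≤ 1 := by
    rw [abs_of_nonneg (sq_nonneg _)]
    exact (sq_le_one_iff_abs_le_one _).mpr (abs_besselJ_zero_le_one_holds _)
  calc |besselJ 0 (2 * y / U) ^ 2| * |Real.exp y * (1 - Real.exp y) / (1 + Real.exp y) ^ 3|
      ≤ 1 * Real.exp (-y) := by gcongr; exact abs_logisticWeight_deriv_le y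
    _ = Real.exp (-y) := one_mul _

/-- **`d(U) ≤ 1/4`** for every `U > 0`: the Lieb–Wu double occupancy never exceeds its uncorrelated value
(`w' < 0` on `(0, ∞)` and `J₀² ≥ 0` in `liebWuDoubleOccupancy_eq_quarter_add'`). [cite: EsslerEtAl2005, eq. (6.84)] -/
theorem liebWuDoubleOccupancy_le_quarter (hU : 0 < U) : liebWuDoubleOccupancy U ≤ 1 / 4 := by
  rw [liebWuDoubleOccupancy_eq_quarter_add' hU]
  have h : ∫ y in Ioi (0 : ℝ), besselJ 0 (2 * y / U) ^ 2 *
      (Real.exp y * (1 - Real.exp y) / (1 + Real.exp y) ^ 3) ≤ 0 := by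
    refine setIntegral_nonpos measurableSet_Ioi fun y hy => ?_
    have hy : (0 : ℝ) < y := hy
    have hW : Real.exp y * (1 - Real.exp y) / (1 + Real.exp y) ^ 3 ≤ 0 := by
      apply div_nonpos_of_nonpos_of_nonneg _ (by positivity)
      have : 1 ≤ Real.exp y := Real.one_le_exp hy.le
      exact mul_nonpos_iff.mpr (Or.inl ⟨(Real.exp_pos y).le, by linarith⟩)
    exact mul_nonpos_iff.mpr (Or.inl ⟨sq_nonneg _, hW⟩)
  linarith

/-- **`0 ≤ d(U)`** for every `U > 0` (`J₀² ≤ 1`, so `∫ J₀(2y/U)² w' ≥ ∫ w' = -1/4`). [cite: EsslerEtAl2005, eq. (6.84)] -/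
theorem liebWuDoubleOccupancy_nonneg (hU : 0 < U) : 0 ≤ liebWuDoubleOccupancy U := by
  rw [liebWuDoubleOccupancy_eq_quarter_add' hU]
  have h : ∫ y in Ioi (0 : ℝ), Real.exp y * (1 - Real.exp y) / (1 + Real.exp y) ^ 3 ≤
      ∫ y in Ioi (0 : ℝ), besselJ 0 (2 * y / U) ^ 2 * (Real.exp y * (1 - Real.exp y) / (1 + Real.exp y) ^ 3) := by
    have hW_cont : Continuous fun y : ℝ => Real.exp y * (1 - Real.exp y) / (1 + Real.exp y) ^ 3 :=
      Continuous.div (by fun_prop) (by fun_prop) fun y => by positivity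
    have hint : IntegrableOn (fun y => Real.exp y * (1 - Real.exp y) / (1 + Real.exp y) ^ 3) (Ioi 0) := by
      refine Integrable.mono' integrableOn_exp_neg_Ioi_zero hW_cont.aestronglyMeasurable (Eventually.of_forall fun y => ?_)
      rw [Real.norm_eq_abs]
      exact abs_logisticWeight_deriv_le y
    refine setIntegral_mono_on hint (integrableOn_besselJ_sq_mul_logisticWeight_deriv U) measurableSet_Ioi
      fun y hy => ?_
    have hy : (0 : ℝ) < y := hy
    have hW : Real.exp y * (1 - Real.exp y) / (1 + Real.exp y) ^ 3 ≤ 0 := by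
      apply div_nonpos_of_nonpos_of_nonneg _ (by positivity)
      have : 1 ≤ Real.exp y := Real.one_le_exp hy.le
      exact mul_nonpos_iff.mpr (Or.inl ⟨(Real.exp_pos y).le, by linarith⟩)
    have hJ : besselJ 0 (2 * y / U) ^ 2 ≤ 1 :=
      (sq_le_one_iff_abs_le_one _).mpr (abs_besselJ_zero_le_one_holds _)
    nlinarith [sq_nonneg (besselJ 0 (2 * y / U))]
  rw [integral_logisticWeight_deriv] at h
  linarith

/-- **`d(U) → 0` as `U → ∞`** (no doubly occupied sites at `U = ∞`): in `liebWuDoubleOccupancy_eq_quarter_add'`,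
`J₀(2y/U) → J₀(0) = 1`, so the correction tends to `∫₀^∞ w' = -1/4` (dominated convergence). [cite: LiebWuPRL1968, eq. (20)] -/
theorem tendsto_liebWuDoubleOccupancy_atTop : Tendsto liebWuDoubleOccupancy atTop (𝓝 0) := by
  set W : ℝ → ℝ := fun y => Real.exp y * (1 - Real.exp y) / (1 + Real.exp y) ^ 3 with hW
  have hW_cont : Continuous W := by
    rw [hW]; exact Continuous.div (by fun_prop) (by fun_prop) fun y => by positivity
  have h := tendsto_integral_filter_of_dominated_convergence (μ := volume.restrict (Ioi (0 : ℝ)))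
    (l := atTop) (F := fun U y => besselJ 0 (2 * y / U) ^ 2 * W y) (f := fun y => W y)
    (fun y => Real.exp (-y)) ?_ ?_ ?_ ?_
  · have hval : ∫ y in Ioi (0 : ℝ), W y = -(1 / 4) := integral_logisticWeight_deriv
    rw [hval] at h
    have h2 := h.const_add (1 / 4)
    rw [show (1 : ℝ) / 4 + -(1 / 4) = 0 by norm_num] at h2
    refine h2.congr' ?_
    filter_upwards [eventually_gt_atTop (0 : ℝ)] with U hU
    exact (liebWuDoubleOccupancy_eq_quarter_add' hU).symm
  · refine Eventually.of_forall fun U => ?_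
    have hc : Continuous fun y => besselJ 0 (2 * y / U) ^ 2 * W y :=
      (((continuous_besselJ_holds 0).comp (by fun_prop : Continuous fun y : ℝ => 2 * y / U)).pow 2).mul hW_cont
    exact hc.aestronglyMeasurable
  · refine Eventually.of_forall fun U => ae_of_all _ fun y => ?_
    rw [Real.norm_eq_abs, abs_mul]
    have h1 : |besselJ 0 (2 * y / U) ^ 2| ≤ 1 := by
      rw [abs_of_nonneg (sq_nonneg _)]
      exact (sq_le_one_iff_abs_le_one _).mpr (abs_besselJ_zero_le_one_holds _)
    calc |besselJ 0 (2 * y / U) ^ 2| * |W y| ≤ 1 * Real.exp (-y) := by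
          gcongr; exact abs_logisticWeight_deriv_le y
      _ = Real.exp (-y) := one_mul _
  · exact integrableOn_exp_neg_Ioi_zero
  · refine ae_of_all _ fun y => ?_
    have hx : Tendsto (fun U : ℝ => 2 * y / U) atTop (𝓝 0) := tendsto_const_nhds.div_atTop tendsto_id
    have hJ : Tendsto (fun U : ℝ => besselJ 0 (2 * y / U)) atTop (𝓝 1) := by
      have := ((continuous_besselJ_holds 0).tendsto 0).comp hx
      rwa [besselJ_zero_zero] at this
    have := (hJ.pow 2).mul_const (W y)
    simpa using this

/-- **`e` is non-decreasing on `(0, ∞)`** (`e' = d ≥ 0`). [cite: LiebWuPRL1968, eq. (20)] -/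
theorem monotoneOn_liebWuEnergy : MonotoneOn liebWuEnergy (Ioi 0) := by
  refine monotoneOn_of_deriv_nonneg (convex_Ioi 0) ?_ ?_ ?_
  · exact fun x hx => (differentiableAt_liebWuEnergy hx).continuousAt.continuousWithinAt
  · rw [interior_Ioi]; exact fun x hx => (differentiableAt_liebWuEnergy hx).differentiableWithinAt
  · rw [interior_Ioi]; intro x hx
    rw [deriv_liebWuEnergy hx]; exact liebWuDoubleOccupancy_nonneg hx

/-- **`U ↦ e(U) - U/4` is non-increasing on `(0, ∞)`** (`(e - U/4)' = d - 1/4 ≤ 0`). [cite: EsslerEtAl2005, eq. (6.84)] -/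
theorem antitoneOn_liebWuEnergy_sub_quarter_mul : AntitoneOn (fun V => liebWuEnergy V - V / 4) (Ioi 0) := by
  refine antitoneOn_of_deriv_nonpos (convex_Ioi 0) ?_ ?_ ?_
  · exact fun x hx => ((differentiableAt_liebWuEnergy hx).sub
      ((differentiableAt_id).div_const 4)).continuousAt.continuousWithinAt
  · rw [interior_Ioi]
    exact fun x hx => ((differentiableAt_liebWuEnergy hx).sub
      ((differentiableAt_id).div_const 4)).differentiableWithinAt
  · rw [interior_Ioi]; intro x hx
    have hd : HasDerivAt (fun V => liebWuEnergy V - V / 4) (liebWuDoubleOccupancy x - 1 / 4) x := by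
      have h1 := hasDerivAt_liebWuEnergy hx
      have h2 : HasDerivAt (fun V : ℝ => V / 4) (1 / 4) x := (hasDerivAt_id x).div_const 4
      exact h1.sub h2
    rw [hd.deriv]
    linarith [liebWuDoubleOccupancy_le_quarter hx]

/-- **`e(U) → 0` as `U → ∞`** (from the strong-coupling bound `|e(U) + 4 ln 2/U| ≤ 64/(U(U² - 16))`, `U > 4`).
[cite: OitmaaHamerZheng2006, §8.2.1 eq. (8.7)] -/
theorem tendsto_liebWuEnergy_atTop : Tendsto liebWuEnergy atTop (𝓝 0) := by
  have hbound : ∀ᶠ U in atTop, |liebWuEnergy U| ≤ 6 * U⁻¹ := by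
    filter_upwards [eventually_ge_atTop (8 : ℝ)] with U hU
    have hU4 : (4 : ℝ) < U := by linarith
    have h := abs_liebWuEnergy_add_four_log_two_div_le' hU4
    have hU0 : (0 : ℝ) < U := by linarith
    have h64 : 64 / (U * (U ^ 2 - 16)) ≤ 2 / U := by
      rw [div_le_div_iff₀ (by nlinarith) hU0]
      nlinarith
    have hlg : |4 * Real.log 2 / U| ≤ 4 / U * 1 := by
      rw [abs_of_nonneg (by positivity), mul_one, div_le_div_iff₀ hU0 hU0]
      have hlog : Real.log 2 < 1 := by
        have := Real.log_lt_sub_one_of_pos (by norm_num : (0 : ℝ) < 2) (by norm_num : (2 : ℝ) ≠ 1)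
        linarith
      nlinarith [Real.log_nonneg (by norm_num : (1 : ℝ) ≤ 2)]
    calc |liebWuEnergy U| = |(liebWuEnergy U + 4 * Real.log 2 / U) - 4 * Real.log 2 / U| := by ring_nf
      _ ≤ |liebWuEnergy U + 4 * Real.log 2 / U| + |4 * Real.log 2 / U| := abs_sub _ _
      _ ≤ 64 / (U * (U ^ 2 - 16)) + 4 / U * 1 := add_le_add h hlg
      _ ≤ 2 / U + 4 / U * 1 := by gcongr
      _ = 6 * U⁻¹ := by
          rw [mul_one, ← add_div, div_eq_mul_inv]
          norm_num
  have h0 : Tendsto (fun U : ℝ => 6 * U⁻¹) atTop (𝓝 0) := by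
    simpa using tendsto_inv_atTop_zero.const_mul (6 : ℝ)
  exact squeeze_zero_norm' (by simpa only [Real.norm_eq_abs] using hbound) h0

/-- **`e(U) ≤ 0`** for every `U > 0` (monotone with limit `0` at `∞`). [cite: LiebWuPRL1968, eq. (20)] -/
theorem liebWuEnergy_nonpos (hU : 0 < U) : liebWuEnergy U ≤ 0 := by
  have hev : ∀ᶠ V in atTop, liebWuEnergy U ≤ liebWuEnergy V := by
    filter_upwards [eventually_ge_atTop U] with V hV
    exact monotoneOn_liebWuEnergy hU (lt_of_lt_of_le hU hV) hV
  exact ge_of_tendsto tendsto_liebWuEnergy_atTop hev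

/-- **`e(U) ≥ -4/π`** for every `U > 0`: `e` is non-decreasing (`e' = d ≥ 0`) with `e(0⁺) = -4/π`.
[cite: LiebWuPRL1968, eq. (20)] -/
theorem neg_four_div_pi_le_liebWuEnergy (hU : 0 < U) : -4 / π ≤ liebWuEnergy U := by
  have hmono := monotoneOn_liebWuEnergy
  have hev : ∀ᶠ ε in 𝓝[>] (0 : ℝ), liebWuEnergy ε ≤ liebWuEnergy U := by
    filter_upwards [Ioo_mem_nhdsGT hU] with ε hε
    exact hmono hε.1 hU hε.2.le
  have hlim := tendsto_liebWuEnergy_zero_holds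
  unfold tendsto_liebWuEnergy_zero at hlim
  exact le_of_tendsto hlim hev

/-- **The Hartree–Fock bound `e(U) ≤ -4/π + U/4`** for every `U > 0`: `e(V) - V/4` is non-increasing
(`(e - V/4)' = d - 1/4 ≤ 0`) with limit `-4/π` at `0⁺`. (For the chain this is the variational bound of the
paramagnetic Hartree–Fock state; here it is a theorem about the Bethe-ansatz function.) [cite: EsslerEtAl2005, eq. (6.84)] -/
theorem liebWuEnergy_le_hartreeFock (hU : 0 < U) : liebWuEnergy U ≤ -4 / π + U / 4 := by
  have hanti := antitoneOn_liebWuEnergy_sub_quarter_mul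
  have hev : ∀ᶠ ε in 𝓝[>] (0 : ℝ), liebWuEnergy U - U / 4 ≤ liebWuEnergy ε - ε / 4 := by
    filter_upwards [Ioo_mem_nhdsGT hU] with ε hε
    exact hanti hε.1 hU hε.2.le
  have hlim : Tendsto (fun ε : ℝ => liebWuEnergy ε - ε / 4) (𝓝[>] 0) (𝓝 (-4 / π)) := by
    have h1 := tendsto_liebWuEnergy_zero_holds
    unfold tendsto_liebWuEnergy_zero at h1
    have h2 : Tendsto (fun ε : ℝ => ε / 4) (𝓝[>] 0) (𝓝 0) := by
      have := ((continuous_id.div_const (4 : ℝ)).tendsto 0).mono_left (nhdsWithin_le_nhds (s := Ioi (0 : ℝ)))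
      simpa using this
    have := h1.sub h2
    simpa using this
  have := ge_of_tendsto hlim hev
  linarith

end WeakCoupling

end Literature.Analysis.FunctionSpaces
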